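import Mathlib
import Summits.Ventures.PercRepro2.Defs
import Summits.Ventures.PercRepro2.Harris
import Summits.Ventures.PercRepro2.Graph
import Summits.Ventures.PercRepro2.Events
import Summits.Ventures.PercRepro2.Statements
import Summits.Ventures.PercRepro2.BHK
import Summits.Ventures.PercRepro2.BHKEvents
import Summits.Ventures.PercRepro2.ClusterProperty

/-!
# The two-root W inequality (row 2′W2) — a corollary of BHK 1.3 + 1.4 (blind cell PercRepro2,
mine-1 g15; proofs/LEAD-TWOROOT.md (lead g22), proofs/MINE1-W-THEOREM.md §7 (a))

For two roots `s, t` of ONE configuration conditioned on `D = {s ↮ t}`, and monotone functionals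
`F, G : Set V → R` of the cluster, put `ΔF = F(C(s)) − F(C(t))`, `ΔG = G(C(s)) − G(C(t))`.
**`twoRootW`**: `Cov_D(ΔF, ΔG) ≥ 0`, multiplied out:
`E[ΔF 1_D] · E[ΔG 1_D] ≤ E[ΔF ΔG 1_D] · P(D)`.
With `F = 1{b ∈ ·}`, `G = 1{o ∈ ·}` this is «given `s ↮ t` the side signs `σ_b, σ_o` are
positively correlated», `Cov_Q(σ_b, σ_o) ≥ 0` (engine D210 / lead census: 0 failures).
Proof: expand the covariance into four terms; the two same-cluster terms are `≥ 0` by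
van den Berg–Häggström–Kahn Thm 1.3 (`bhk_same_cluster_fun`, at `s` and at `t`), the two
cross-cluster terms are `≤ 0` by Thm 1.4 (`bhk_cross_cluster_fun`, both orientations); the
covariance is invariant under shifting `F, G` by constants, which supplies the nonnegativity BHK
asks for. (So the «unbounded-degree alternating proof strategy» is not needed here: the two-root
case is the four-term shadow of BHK.)
-/

namespace Summit.Ventures.PercRepro2

section TwoRootW

variable {V : Type*} {E : Type*} [Fintype E] [DecidableEq E] [Fintype V] [DecidableEq V]
  {R : Type*} [Field R] [LinearOrder R] [IsStrictOrderedRing R]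
variable (p : E → R) (ends : E → Sym2 V) (s t : V)

omit [Fintype V] [DecidableEq V] [LinearOrder R] [IsStrictOrderedRing R] in
/-- Expanding `E[(a − b)(c − d) i]`. -/
lemma expect_sub_mul_sub_mul (a b c d i : Config E → R) :
    expect p (fun ω => (a ω - b ω) * (c ω - d ω) * i ω) =
      expect p (fun ω => a ω * c ω * i ω) - expect p (fun ω => a ω * d ω * i ω) -
        expect p (fun ω => b ω * c ω * i ω) + expect p (fun ω => b ω * d ω * i ω) := by
  unfold expect
  rw [← Finset.sum_sub_distrib, ← Finset.sum_sub_distrib, ← Finset.sum_add_distrib]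
  refine Finset.sum_congr rfl fun ω _ => ?_
  ring

omit [Fintype V] [DecidableEq V] [LinearOrder R] [IsStrictOrderedRing R] in
/-- Expanding `E[(a − b) i]`. -/
lemma expect_sub_mul (a b i : Config E → R) :
    expect p (fun ω => (a ω - b ω) * i ω) =
      expect p (fun ω => a ω * i ω) - expect p (fun ω => b ω * i ω) := by
  unfold expect
  rw [← Finset.sum_sub_distrib]
  refine Finset.sum_congr rfl fun ω _ => ?_
  ring

omit [Fintype E] [DecidableEq E] [Fintype V] [DecidableEq V] [LinearOrder R] [IsStrictOrderedRing R] in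
/-- The cluster functional `C ↦ F C − c` as a cluster property. -/
lemma clusterFun_sub_apply (F : Set V → R) (c : R) (x : V) (ω : Config E) :
    clusterFun ends (fun C => F C - c) x ω = F (cluster ends ω x) - c := rfl

/-- **The two-root W inequality** (row 2′W2): for monotone `F, G : Set V → R`, under
`D = {s ↮ t}`, `E[ΔF 1_D] · E[ΔG 1_D] ≤ E[ΔF ΔG 1_D] · P(D)` with
`ΔF ω = F(C_ω(s)) − F(C_ω(t))`, `ΔG ω = G(C_ω(s)) − G(C_ω(t))`. -/
theorem twoRootW (hp : IsProbVec p) {F G : Set V → R} (hF : Monotone F) (hG : Monotone G) :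
    expect p (fun ω => (F (cluster ends ω s) - F (cluster ends ω t)) *
        ((connEvent ends s t)ᶜ).indicator 1 ω) *
      expect p (fun ω => (G (cluster ends ω s) - G (cluster ends ω t)) *
        ((connEvent ends s t)ᶜ).indicator 1 ω) ≤
    expect p (fun ω => (F (cluster ends ω s) - F (cluster ends ω t)) *
        (G (cluster ends ω s) - G (cluster ends ω t)) * ((connEvent ends s t)ᶜ).indicator 1 ω) *
      prob p (connEvent ends s t)ᶜ := by
  classical
  -- shift `F, G` to nonnegative functionals (the statement is invariant under the shift)
  set cF : R := Finset.univ.inf' (Finset.univ_nonempty (α := Set V)) F with hcF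
  set cG : R := Finset.univ.inf' (Finset.univ_nonempty (α := Set V)) G with hcG
  set F' : Set V → R := fun C => F C - cF with hF'
  set G' : Set V → R := fun C => G C - cG with hG'
  have hF'm : Monotone F' := fun _ _ h => sub_le_sub_right (hF h) cF
  have hG'm : Monotone G' := fun _ _ h => sub_le_sub_right (hG h) cG
  have hF'0 : ∀ C, 0 ≤ F' C := fun C => sub_nonneg.mpr (Finset.inf'_le F (Finset.mem_univ C))
  have hG'0 : ∀ C, 0 ≤ G' C := fun C => sub_nonneg.mpr (Finset.inf'_le G (Finset.mem_univ C))
  have eF : ∀ ω, F (cluster ends ω s) - F (cluster ends ω t) =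
      F' (cluster ends ω s) - F' (cluster ends ω t) := fun ω => by simp only [hF']; ring
  have eG : ∀ ω, G (cluster ends ω s) - G (cluster ends ω t) =
      G' (cluster ends ω s) - G' (cluster ends ω t) := fun ω => by simp only [hG']; ring
  simp only [eF, eG]
  clear_value F' G'
  -- the four BHK inequalities
  set D : Set (Config E) := (connEvent ends s t)ᶜ with hD
  have hDts : (connEvent ends t s)ᶜ = D := by rw [hD, connEvent_comm]
  have hFp := isMonotoneClusterProperty_clusterFun ends hF'm
  have hGp := isMonotoneClusterProperty_clusterFun ends hG'm
  have h1 := bhk_same_cluster_fun p hp ends s t hFp hGp (fun ω => hF'0 _) (fun ω => hG'0 _)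
  have h2 := bhk_same_cluster_fun p hp ends t s hFp hGp (fun ω => hF'0 _) (fun ω => hG'0 _)
  have h3 := bhk_cross_cluster_fun p hp ends s t hFp hGp (fun ω => hF'0 _)
  have h4 := bhk_cross_cluster_fun p hp ends t s hFp hGp (fun ω => hF'0 _)
  simp only [clusterFun, hDts, ← hD] at h1 h2 h3 h4
  -- expand
  rw [expect_sub_mul_sub_mul p, expect_sub_mul p, expect_sub_mul p]
  have c1 : expect p (fun ω => F' (cluster ends ω t) * G' (cluster ends ω s) * D.indicator 1 ω) =
      expect p (fun ω => G' (cluster ends ω s) * F' (cluster ends ω t) * D.indicator 1 ω) := by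
    unfold expect; refine Finset.sum_congr rfl fun ω _ => ?_; ring
  have c2 : expect p (fun ω => F' (cluster ends ω t) * G' (cluster ends ω t) * D.indicator 1 ω) =
      expect p (fun ω => F' (cluster ends ω t) * G' (cluster ends ω t) * D.indicator 1 ω) := rfl
  nlinarith [h1, h2, h3, h4, c1]

end TwoRootW

end Summit.Ventures.PercRepro2
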